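import Summits.CriticalPhenomena.PercolationContinuityZ3.Theses.PercTiltedBlockers
import Summits.CriticalPhenomena.PercolationContinuityZ3.Theses.PercAnnulusCrossing

/-!
# `AnnulusAssembly` (route PercTiltedBlockers) = `Assembly` (route PercAnnulusCrossing)

Item `stmt-CriticalPhenomena-0847`: the folklore glue
`CrossingTendstoOne → CritAnnulusNonCrossing → PercolationContinuityZ3` on `ℤ³`.

Proof: `θ ≥ 0` (a probability); if `θ(p_c) ≠ 0` then `θ(p_c) > 0`, so by the first hypothesis the
annulus-crossing probabilities `P_{p_c}(B(n) ↔ ∂B(2n) inside B(2n))` tend to `1`, and eventually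
exceed `1 - c`, contradicting the uniform bound `≤ 1 - c` (`c > 0`) of the second hypothesis at
`n = max N 1 ≥ 1`.
-/

namespace Summit.CriticalPhenomena.PercolationContinuityZ3.Theorems

/-- Item `stmt-CriticalPhenomena-0847` for route PercTiltedBlockers: `AnnulusAssembly` holds —
if `θ(p) > 0` forces the annulus-crossing probabilities at `p` to tend to `1`, and at `p_c(ℤ³)` they
are uniformly `≤ 1 - c < 1`, then `θ(p_c(ℤ³)) = 0`. -/
theorem percTiltedBlockers_annulusAssembly_proof :
    Summit.CriticalPhenomena.PercolationContinuityZ3.Theses.PercTiltedBlockers.AnnulusAssembly := by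
  unfold Summit.CriticalPhenomena.PercolationContinuityZ3.Theses.PercTiltedBlockers.AnnulusAssembly
  intro hOne hB
  refine Literature.Probability.Percolation.percolationContinuityZ3_iff.2
    (le_antisymm (not_lt.1 fun hθ => ?_) MeasureTheory.measureReal_nonneg)
  obtain ⟨c, hc, hb⟩ := hB
  obtain ⟨N, hN⟩ :=
    Filter.eventually_atTop.1 ((hOne _ hθ).eventually_const_lt (sub_lt_self (1 : ℝ) hc))
  exact absurd (hb (max N 1) (le_max_right N 1)) (not_le.2 (hN (max N 1) (le_max_left N 1)))

/-- Item `stmt-CriticalPhenomena-0847` for route PercAnnulusCrossing: `Assembly` holds (verbatim the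
same statement as `PercTiltedBlockers.AnnulusAssembly`). -/
theorem percAnnulusCrossing_assembly_proof :
    Summit.CriticalPhenomena.PercolationContinuityZ3.Theses.PercAnnulusCrossing.Assembly :=
  percTiltedBlockers_annulusAssembly_proof

end Summit.CriticalPhenomena.PercolationContinuityZ3.Theorems
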